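import Mathlib
import Literature.Analysis.FunctionSpaces.GaussianSchwartz
import Literature.MathematicalPhysics.QuantumLattice.EuclideanAction

/-!
# Route `UniversalDetector`, crux `DetectorRigidity` (stmt-QuantumFields-26595): the Gaussian slice identity

Ideator seat ym-idea-8 g4.  This file proves the first plumbing statement (`hslice`, "SliceIdentity") of
`semigroupKill_of_slice_of_cs` (`UniversalDetectorSemigroupKillReduction.lean`), verbatim: for a kernel `K` on `ℝ⁴`
continuous off the origin and bounded away from it there are `Φ` continuous on `(0,∞)` and `κ > 0` such that for
all Gaussian-profile test vectors `w_a(y) = a(y₀) e^{-‖y‖²}`, `w_c` with continuous compactly supported positive-time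
profiles
`∫∫ (Θ w_a)(x) w_c(y) K(y - x) dx dy = κ ∫∫ a(s) e^{-s²} c(t) e^{-t²} Φ(s + t) ds dt`.
We take `κ = 1` and `Φ(u) = ∫_{ℝ³ × ℝ³} e^{-|v|² - |w|²} K(ι(u, w - v)) dv dw`, where `ι : ℝ × ℝ³ ≃ ℝ⁴` is the inverse
of a volume-preserving time/space splitting (`exists_split`: `MeasurableEquiv.toLp`, `MeasurableEquiv.piFinSuccAbove`).
Steps: Fubini on `ℝ⁴ × ℝ⁴` (time-separated supports make the integrand integrable); transport along the splitting of
both points; the regrouping `((s,t),(v,w)) ↦ ((s,v),(t,w))` (measure preserving, from Mathlib's associators and the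
swap); Fubini `(ℝ × ℝ) × (ℝ³ × ℝ³)`; the reflection `s ↦ -s` in the first time variable.  Continuity of `Φ` on `(0,∞)`
is dominated convergence (`|K| ≤ C` on `‖z‖ ≥ u₀/2`).
Together with `mirrorCauchySchwarz`, `semigroupKill_of_slice_of_cs`, `detectorRigidity_of_semigroupKill` this closes
the crux `DetectorRigidity` (see `UniversalDetectorRigidity.lean`).  No summit, leg or spine crux is proved here.
-/

set_option autoImplicit false

noncomputable section

open MeasureTheory Filter Set WithLp
open scoped Topology
open Literature.MathematicalPhysics.QuantumLattice Literature.Analysis.FunctionSpaces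

namespace Summit.QuantumFields.YangMills.Cruxes.DetectorRigidity

/-! ### Part 1: the time/space splitting `ℝ⁴ ≃ ℝ × ℝ³` -/

/-- A volume-preserving measurable equivalence `ℝ⁴ ≃ ℝ × ℝ³` splitting off the time coordinate, with the coordinate,
norm, linearity and continuity facts used below. -/
private theorem exists_split :
    ∃ e : EuclideanSpace ℝ (Fin 4) ≃ᵐ ℝ × EuclideanSpace ℝ (Fin 3),
      MeasurePreserving e volume volume ∧
      (∀ (s : ℝ) (v : EuclideanSpace ℝ (Fin 3)), (e.symm (s, v)) 0 = s) ∧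
      (∀ (s : ℝ) (v : EuclideanSpace ℝ (Fin 3)), ‖e.symm (s, v)‖ ^ 2 = s ^ 2 + ‖v‖ ^ 2) ∧
      (∀ p q : ℝ × EuclideanSpace ℝ (Fin 3), e.symm p - e.symm q = e.symm (p - q)) ∧
      Continuous e.symm := by
  let e4 : EuclideanSpace ℝ (Fin 4) ≃ᵐ (Fin 4 → ℝ) := (MeasurableEquiv.toLp 2 (Fin 4 → ℝ)).symm
  let eS : (Fin 4 → ℝ) ≃ᵐ ℝ × (Fin 3 → ℝ) := MeasurableEquiv.piFinSuccAbove (fun _ : Fin 4 => ℝ) 0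
  let e3 : (Fin 3 → ℝ) ≃ᵐ EuclideanSpace ℝ (Fin 3) := MeasurableEquiv.toLp 2 (Fin 3 → ℝ)
  let e : EuclideanSpace ℝ (Fin 4) ≃ᵐ ℝ × EuclideanSpace ℝ (Fin 3) :=
    e4.trans (eS.trans (MeasurableEquiv.prodCongr (MeasurableEquiv.refl ℝ) e3))
  have hsymm : ∀ (s : ℝ) (v : EuclideanSpace ℝ (Fin 3)),
      e.symm (s, v) = toLp 2 (Fin.cons s (ofLp v) : Fin 4 → ℝ) := by
    intro s v
    show toLp 2 ((MeasurableEquiv.piFinSuccAbove (fun _ : Fin 4 => ℝ) 0).symm (s, ofLp v)) = _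
    rw [MeasurableEquiv.piFinSuccAbove_symm_apply]
    change toLp 2 (Fin.insertNth 0 s (ofLp v) : Fin 4 → ℝ) = _
    rw [Fin.insertNth_zero']
  refine ⟨e, ?_, ?_, ?_, ?_, ?_⟩
  · exact ((MeasurePreserving.id (volume : Measure ℝ)).prod (PiLp.volume_preserving_toLp (Fin 3))).comp
      ((volume_preserving_piFinSuccAbove (fun _ : Fin 4 => ℝ) 0).comp
        (EuclideanSpace.volume_preserving_symm_measurableEquiv_toLp (Fin 4)))
  · intro s v
    rw [hsymm]
    simp
  · intro s v
    rw [hsymm, EuclideanSpace.norm_sq_eq, EuclideanSpace.norm_sq_eq, Fin.sum_univ_succ]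
    simp
  · intro p q
    obtain ⟨s₁, v₁⟩ := p
    obtain ⟨s₂, v₂⟩ := q
    rw [Prod.mk_sub_mk, hsymm, hsymm, hsymm, ← toLp_sub]
    congr 1
    funext i
    refine Fin.cases ?_ (fun j => ?_) i
    · simp
    · simp
  · have : (fun p : ℝ × EuclideanSpace ℝ (Fin 3) => e.symm p) =
        fun p => toLp 2 (Fin.cons p.1 (ofLp p.2) : Fin 4 → ℝ) := by
      funext p; exact hsymm p.1 p.2
    show Continuous fun p : ℝ × EuclideanSpace ℝ (Fin 3) => e.symm p
    rw [this]
    refine (PiLp.continuous_toLp 2 (fun _ : Fin 4 => ℝ)).comp ?_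
    refine continuous_pi fun i => ?_
    refine Fin.cases ?_ (fun j => ?_) i
    · simpa using continuous_fst
    · have hj : Continuous fun a : ℝ × EuclideanSpace ℝ (Fin 3) => (a.2) j :=
        (EuclideanSpace.proj (j : Fin 3) : EuclideanSpace ℝ (Fin 3) →L[ℝ] ℝ).continuous.comp continuous_snd
      simpa using hj

/-! ### Part 2: slabs, the pairing as a product integral, the regrouping -/

/-- `|u₀| ≤ ‖u‖` on `ℝ⁴`. -/
private theorem abs_coord_le_norm₃ (u : EuclideanSpace ℝ (Fin 4)) : |u 0| ≤ ‖u‖ := by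
  have h := abs_real_inner_le_norm (EuclideanSpace.single (0 : Fin 4) (1 : ℝ)) u
  rw [EuclideanSpace.inner_single_left] at h
  simpa using h

/-- The time coordinate is continuous on `ℝ⁴`. -/
private theorem continuous_coord₃ : Continuous fun y : EuclideanSpace ℝ (Fin 4) => y 0 :=
  (EuclideanSpace.proj (0 : Fin 4) : EuclideanSpace ℝ (Fin 4) →L[ℝ] ℝ).continuous

/-- The positive time slab is closed. -/
private theorem isClosed_slab₃ (t T : ℝ) : IsClosed {y : EuclideanSpace ℝ (Fin 4) | t ≤ y 0 ∧ y 0 ≤ T} :=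
  (isClosed_le continuous_const continuous_coord₃).inter (isClosed_le continuous_coord₃ continuous_const)

/-- A Gaussian-profile vector with compactly supported positive-time profile lives in a positive slab. -/
private theorem profile_slab {a : ℝ → ℝ} {w : SchwartzMap (EuclideanSpace ℝ (Fin 4)) ℝ}
    (hac : HasCompactSupport a) (ha0 : tsupport a ⊆ Ioi 0)
    (hw : ∀ y, w y = a (y 0) * Real.exp (-‖y‖ ^ 2)) :
    ∃ t T : ℝ, 0 < t ∧ tsupport (w : EuclideanSpace ℝ (Fin 4) → ℝ) ⊆ {y | t ≤ y 0 ∧ y 0 ≤ T} := by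
  have key : ∀ t T : ℝ, tsupport a ⊆ Icc t T →
      tsupport (w : EuclideanSpace ℝ (Fin 4) → ℝ) ⊆ {y | t ≤ y 0 ∧ y 0 ≤ T} := by
    intro t T ha
    refine closure_minimal (fun y hy => ?_) (isClosed_slab₃ t T)
    have hy' : a (y 0) ≠ 0 := by
      intro h0
      exact hy (by rw [hw, h0, zero_mul])
    exact ha (subset_tsupport _ (Function.mem_support.mpr hy'))
  rcases (tsupport a).eq_empty_or_nonempty with h | h
  · exact ⟨1, 1, one_pos, key 1 1 (by rw [h]; exact empty_subset _)⟩
  · exact ⟨sInf (tsupport a), sSup (tsupport a), ha0 (hac.sInf_mem h),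
      key _ _ fun x hx => ⟨csInf_le hac.bddBelow hx, le_csSup hac.bddAbove hx⟩⟩

/-- Time separation of slab supports. -/
private theorem slab_separation₃ {u v : SchwartzMap (EuclideanSpace ℝ (Fin 4)) ℝ} {tu Tu tv Tv : ℝ}
    (hu : tsupport (u : EuclideanSpace ℝ (Fin 4) → ℝ) ⊆ {y | tu ≤ y 0 ∧ y 0 ≤ Tu})
    (hv : tsupport (v : EuclideanSpace ℝ (Fin 4) → ℝ) ⊆ {y | tv ≤ y 0 ∧ y 0 ≤ Tv})
    {x y : EuclideanSpace ℝ (Fin 4)} (hx : thetaTest 4 u x ≠ 0) (hy : v y ≠ 0) :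
    tu + tv ≤ ‖y - x‖ := by
  rw [thetaTest_apply] at hx
  have h1 := hu (subset_tsupport _ (Function.mem_support.mpr hx))
  have h2 := hv (subset_tsupport _ (Function.mem_support.mpr hy))
  simp only [mem_setOf_eq] at h2
  simp [timeReflection_apply] at h1
  calc tu + tv ≤ (y - x) 0 := by simp; linarith [h1.1, h2.1]
    _ ≤ |(y - x) 0| := le_abs_self _
    _ ≤ ‖y - x‖ := abs_coord_le_norm₃ _

/-- The mirror-pairing integrand of two positive-slab Schwartz functions is integrable on `ℝ⁴ × ℝ⁴`. -/
private theorem pair_integrable₃ {K : EuclideanSpace ℝ (Fin 4) → ℝ} (hc : ContinuousOn K {z | z ≠ 0})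
    (hb : ∀ η : ℝ, 0 < η → ∃ C : ℝ, ∀ z : EuclideanSpace ℝ (Fin 4), η ≤ ‖z‖ → |K z| ≤ C)
    {u v : SchwartzMap (EuclideanSpace ℝ (Fin 4)) ℝ} {tu Tu tv Tv : ℝ} (htu : 0 < tu) (htv : 0 < tv)
    (hu : tsupport (u : EuclideanSpace ℝ (Fin 4) → ℝ) ⊆ {y | tu ≤ y 0 ∧ y 0 ≤ Tu})
    (hv : tsupport (v : EuclideanSpace ℝ (Fin 4) → ℝ) ⊆ {y | tv ≤ y 0 ∧ y 0 ≤ Tv}) :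
    Integrable (fun z : EuclideanSpace ℝ (Fin 4) × EuclideanSpace ℝ (Fin 4) =>
        thetaTest 4 u z.1 * v z.2 * K (z.2 - z.1))
      ((volume : Measure (EuclideanSpace ℝ (Fin 4))).prod volume) := by
  obtain ⟨C, hC⟩ := hb (tu + tv) (by positivity)
  have hKm : Measurable K := by
    refine measurable_of_continuousOn_compl_singleton 0 ?_
    rw [compl_singleton_eq]; exact hc
  have hmeas : AEStronglyMeasurable (fun z : EuclideanSpace ℝ (Fin 4) × EuclideanSpace ℝ (Fin 4) =>
      thetaTest 4 u z.1 * v z.2 * K (z.2 - z.1)) ((volume : Measure (EuclideanSpace ℝ (Fin 4))).prod volume) :=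
    ((((thetaTest 4 u).continuous.comp continuous_fst).mul (v.continuous.comp continuous_snd)).measurable.mul
      (hKm.comp (measurable_snd.sub measurable_fst))).aestronglyMeasurable
  have hdom : Integrable (fun z : EuclideanSpace ℝ (Fin 4) × EuclideanSpace ℝ (Fin 4) =>
      max C 0 * (‖thetaTest 4 u z.1‖ * ‖v z.2‖)) ((volume : Measure (EuclideanSpace ℝ (Fin 4))).prod volume) :=
    ((thetaTest 4 u).integrable.norm.mul_prod v.integrable.norm).const_mul _
  refine hdom.mono' hmeas (Eventually.of_forall fun z => ?_)
  rw [Real.norm_eq_abs, abs_mul, abs_mul, Real.norm_eq_abs, Real.norm_eq_abs]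
  by_cases h1 : thetaTest 4 u z.1 = 0
  · simp [h1]
  by_cases h2 : v z.2 = 0
  · simp [h2]
  have hK : |K (z.2 - z.1)| ≤ max C 0 := (hC _ (slab_separation₃ hu hv h1 h2)).trans (le_max_left _ _)
  calc |thetaTest 4 u z.1| * |v z.2| * |K (z.2 - z.1)|
      ≤ |thetaTest 4 u z.1| * |v z.2| * max C 0 := by gcongr
    _ = max C 0 * (|thetaTest 4 u z.1| * |v z.2|) := by ring

/-- The regrouping `((s,t),(v,w)) ↦ ((s,v),(t,w))` preserves the product of Lebesgue measures. -/
private theorem measurePreserving_regroup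
    (ρ : (ℝ × ℝ) × (EuclideanSpace ℝ (Fin 3) × EuclideanSpace ℝ (Fin 3)) ≃ᵐ
      (ℝ × EuclideanSpace ℝ (Fin 3)) × (ℝ × EuclideanSpace ℝ (Fin 3)))
    (hρ : ∀ r, ρ r = ((r.1.1, r.2.1), (r.1.2, r.2.2))) :
    MeasurePreserving ρ
      (((volume : Measure ℝ).prod (volume : Measure ℝ)).prod
        ((volume : Measure (EuclideanSpace ℝ (Fin 3))).prod (volume : Measure (EuclideanSpace ℝ (Fin 3)))))
      (((volume : Measure ℝ).prod (volume : Measure (EuclideanSpace ℝ (Fin 3)))).prod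
        ((volume : Measure ℝ).prod (volume : Measure (EuclideanSpace ℝ (Fin 3))))) := by
  set μa : Measure ℝ := volume
  set μb : Measure ℝ := volume
  set μc : Measure (EuclideanSpace ℝ (Fin 3)) := volume
  set μd : Measure (EuclideanSpace ℝ (Fin 3)) := volume
  have h1 := measurePreserving_prodAssoc μa μb (μc.prod μd)
  have h2 := (measurePreserving_prodAssoc μb μc μd).symm MeasurableEquiv.prodAssoc
  have h3 : MeasurePreserving (Prod.map Prod.swap id) ((μb.prod μc).prod μd) ((μc.prod μb).prod μd) :=
    (Measure.measurePreserving_swap (μ := μb) (ν := μc)).prod (MeasurePreserving.id μd)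
  have h4 := measurePreserving_prodAssoc μc μb μd
  have h5 : MeasurePreserving
      (Prod.map (id : ℝ → ℝ) ((MeasurableEquiv.prodAssoc : (EuclideanSpace ℝ (Fin 3) × ℝ) ×
          EuclideanSpace ℝ (Fin 3) ≃ᵐ EuclideanSpace ℝ (Fin 3) × ℝ × EuclideanSpace ℝ (Fin 3)) ∘
        Prod.map Prod.swap id ∘
        (MeasurableEquiv.prodAssoc : (ℝ × EuclideanSpace ℝ (Fin 3)) × EuclideanSpace ℝ (Fin 3) ≃ᵐ
          ℝ × EuclideanSpace ℝ (Fin 3) × EuclideanSpace ℝ (Fin 3)).symm))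
      (μa.prod (μb.prod (μc.prod μd))) (μa.prod (μc.prod (μb.prod μd))) :=
    (MeasurePreserving.id μa).prod (h4.comp (h3.comp h2))
  have h6 := (measurePreserving_prodAssoc μa μc (μb.prod μd)).symm MeasurableEquiv.prodAssoc
  have h := h6.comp (h5.comp h1)
  convert h using 1
  funext p
  rw [hρ]
  rfl

/-! ### Part 3: the Gaussian slice identity -/

/-- **The Gaussian slice identity** (`hslice` of `semigroupKill_of_slice_of_cs`, verbatim): for a kernel continuous
off the origin and bounded away from it there are `Φ` continuous on `(0,∞)` and `κ > 0` with
`B(w_a, w_c) = κ ∫∫ a(s)e^{-s²} c(t)e^{-t²} Φ(s+t) ds dt` for all Gaussian-profile vectors with positive-time profiles.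
Here `κ = 1` and `Φ(u) = ∫_{ℝ³×ℝ³} e^{-|v|²-|w|²} K(u, w - v)`. -/
theorem sliceIdentity :
    ∀ (K : EuclideanSpace ℝ (Fin 4) → ℝ),
      ContinuousOn K {z | z ≠ 0} →
      (∀ η : ℝ, 0 < η → ∃ C : ℝ, ∀ z : EuclideanSpace ℝ (Fin 4), η ≤ ‖z‖ → |K z| ≤ C) →
      ∃ (Φ : ℝ → ℝ) (κ : ℝ), 0 < κ ∧ ContinuousOn Φ (Ioi 0) ∧
        ∀ (a c : ℝ → ℝ) (wa wc : SchwartzMap (EuclideanSpace ℝ (Fin 4)) ℝ),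
          Continuous a → Continuous c → HasCompactSupport a → HasCompactSupport c →
          tsupport a ⊆ Ioi 0 → tsupport c ⊆ Ioi 0 →
          (∀ y, wa y = a (y 0) * Real.exp (-‖y‖ ^ 2)) → (∀ y, wc y = c (y 0) * Real.exp (-‖y‖ ^ 2)) →
          (∫ x, ∫ y, (thetaTest 4 wa) x * wc y * K (y - x)) =
            κ * ∫ p : ℝ × ℝ, (a p.1 * Real.exp (-p.1 ^ 2)) * (c p.2 * Real.exp (-p.2 ^ 2)) * Φ (p.1 + p.2) := by
  intro K hc hb
  obtain ⟨e, he, hP1, hP2, hP3, hP4⟩ := exists_split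
  have hKm : Measurable K := by
    refine measurable_of_continuousOn_compl_singleton 0 ?_
    rw [compl_singleton_eq]; exact hc
  -- the norm of `e.symm (u, w)` dominates `|u|`
  have hnorm : ∀ (u : ℝ) (w : EuclideanSpace ℝ (Fin 3)), |u| ≤ ‖e.symm (u, w)‖ := by
    intro u w
    have h2 : u ^ 2 ≤ ‖e.symm (u, w)‖ ^ 2 := by rw [hP2]; nlinarith [sq_nonneg ‖w‖]
    calc |u| = Real.sqrt (u ^ 2) := (Real.sqrt_sq_eq_abs u).symm
      _ ≤ Real.sqrt (‖e.symm (u, w)‖ ^ 2) := Real.sqrt_le_sqrt h2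
      _ = ‖e.symm (u, w)‖ := Real.sqrt_sq (norm_nonneg _)
  -- the Gaussian weight on `ℝ³ × ℝ³`
  have hgauss : Integrable (fun v : EuclideanSpace ℝ (Fin 3) => Real.exp (-‖v‖ ^ 2)) := by
    refine ((realGaussianSchwartz (EuclideanSpace ℝ (Fin 3)) 1).integrable (μ := volume)).congr
      (Eventually.of_forall fun v => ?_)
    simp [realGaussianSchwartz_apply one_pos]
  have hGG : Integrable (fun q : EuclideanSpace ℝ (Fin 3) × EuclideanSpace ℝ (Fin 3) =>
      Real.exp (-‖q.1‖ ^ 2) * Real.exp (-‖q.2‖ ^ 2))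
      ((volume : Measure (EuclideanSpace ℝ (Fin 3))).prod volume) := hgauss.mul_prod hgauss
  have hGGc : Continuous fun q : EuclideanSpace ℝ (Fin 3) × EuclideanSpace ℝ (Fin 3) =>
      Real.exp (-‖q.1‖ ^ 2) * Real.exp (-‖q.2‖ ^ 2) :=
    (Real.continuous_exp.comp (continuous_fst.norm.pow 2).neg).mul
      (Real.continuous_exp.comp (continuous_snd.norm.pow 2).neg)
  -- the slice kernel
  set Φ : ℝ → ℝ := fun u => ∫ q : EuclideanSpace ℝ (Fin 3) × EuclideanSpace ℝ (Fin 3),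
    Real.exp (-‖q.1‖ ^ 2) * Real.exp (-‖q.2‖ ^ 2) * K (e.symm (u, q.2 - q.1)) with hΦ_def
  have hΦc : ContinuousOn Φ (Ioi 0) := by
    refine continuousOn_of_forall_continuousAt fun u₀ hu₀ => ?_
    simp only [mem_Ioi] at hu₀
    obtain ⟨C, hC⟩ := hb (u₀ / 2) (half_pos hu₀)
    refine continuousAt_of_dominated (bound := fun q => max C 0 * (Real.exp (-‖q.1‖ ^ 2) * Real.exp (-‖q.2‖ ^ 2)))
      ?_ ?_ ?_ ?_
    · exact Eventually.of_forall fun u => (hGGc.measurable.mul (hKm.comp (hP4.measurable.comp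
        (measurable_const.prodMk (measurable_snd.sub measurable_fst))))).aestronglyMeasurable
    · filter_upwards [Ioi_mem_nhds (half_lt_self hu₀)] with u hu
      refine Eventually.of_forall fun q => ?_
      simp only [mem_Ioi] at hu
      rw [Real.norm_eq_abs, abs_mul]
      have hK : |K (e.symm (u, q.2 - q.1))| ≤ max C 0 := by
        refine (hC _ ?_).trans (le_max_left _ _)
        exact (le_of_lt (lt_of_lt_of_le hu (le_abs_self u))).trans (hnorm u _)
      have hg : 0 ≤ Real.exp (-‖q.1‖ ^ 2) * Real.exp (-‖q.2‖ ^ 2) := by positivity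
      rw [abs_of_nonneg hg]
      calc Real.exp (-‖q.1‖ ^ 2) * Real.exp (-‖q.2‖ ^ 2) * |K (e.symm (u, q.2 - q.1))|
          ≤ Real.exp (-‖q.1‖ ^ 2) * Real.exp (-‖q.2‖ ^ 2) * max C 0 := by gcongr
        _ = max C 0 * (Real.exp (-‖q.1‖ ^ 2) * Real.exp (-‖q.2‖ ^ 2)) := by ring
    · have h := hGG.const_mul (max C 0)
      rwa [← Measure.volume_eq_prod] at h
    · refine Eventually.of_forall fun q => ?_
      have hz : e.symm (u₀, q.2 - q.1) ≠ 0 := by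
        intro h0
        have := hnorm u₀ (q.2 - q.1)
        rw [h0, norm_zero] at this
        linarith [abs_nonneg u₀, le_abs_self u₀]
      have hKat : ContinuousAt K (e.symm (u₀, q.2 - q.1)) := hc.continuousAt (isOpen_ne.mem_nhds hz)
      have hpath : Continuous fun u : ℝ => e.symm (u, q.2 - q.1) :=
        hP4.comp (continuous_id.prodMk continuous_const)
      exact continuousAt_const.mul (ContinuousAt.comp_of_eq hKat hpath.continuousAt rfl)
  refine ⟨Φ, 1, one_pos, hΦc, ?_⟩
  intro a c wa wc _ha _hc' hac hcc ha0 hc0 hwa hwc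
  -- STEP 1: slabs and the pairing as one integral over `ℝ⁴ × ℝ⁴`
  obtain ⟨ta, Ta, hta, hsa⟩ := profile_slab hac ha0 hwa
  obtain ⟨tc, Tc, htc, hsc⟩ := profile_slab hcc hc0 hwc
  have hG := pair_integrable₃ hc hb hta htc hsa hsc
  have eq1 : (∫ x, ∫ y, (thetaTest 4 wa) x * wc y * K (y - x)) =
      ∫ z : EuclideanSpace ℝ (Fin 4) × EuclideanSpace ℝ (Fin 4), thetaTest 4 wa z.1 * wc z.2 * K (z.2 - z.1) := by
    rw [Measure.volume_eq_prod, integral_prod _ hG]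
  rw [← Measure.volume_eq_prod] at hG
  set G : EuclideanSpace ℝ (Fin 4) × EuclideanSpace ℝ (Fin 4) → ℝ :=
    fun z => thetaTest 4 wa z.1 * wc z.2 * K (z.2 - z.1) with hG_def
  -- STEP 2: split both points into time and space
  set Ψ : EuclideanSpace ℝ (Fin 4) × EuclideanSpace ℝ (Fin 4) ≃ᵐ
      (ℝ × EuclideanSpace ℝ (Fin 3)) × (ℝ × EuclideanSpace ℝ (Fin 3)) := MeasurableEquiv.prodCongr e e with hΨ_def
  have hΨ : MeasurePreserving Ψ volume volume := he.prod he
  have hΨs : MeasurePreserving Ψ.symm volume volume := hΨ.symm Ψ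
  have eq2 : (∫ z, G z) = ∫ q, G (Ψ.symm q) := (hΨs.integral_comp' G).symm
  -- STEP 3: regroup `((s,v),(t,w)) ↤ ((s,t),(v,w))`
  let ρ : (ℝ × ℝ) × (EuclideanSpace ℝ (Fin 3) × EuclideanSpace ℝ (Fin 3)) ≃ᵐ
      (ℝ × EuclideanSpace ℝ (Fin 3)) × (ℝ × EuclideanSpace ℝ (Fin 3)) :=
    { toEquiv := Equiv.prodProdProdComm ℝ ℝ (EuclideanSpace ℝ (Fin 3)) (EuclideanSpace ℝ (Fin 3))
      measurable_toFun := (measurable_fst.fst.prodMk measurable_snd.fst).prodMk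
        (measurable_fst.snd.prodMk measurable_snd.snd)
      measurable_invFun := (measurable_fst.fst.prodMk measurable_snd.fst).prodMk
        (measurable_fst.snd.prodMk measurable_snd.snd) }
  have hρapp : ∀ r, ρ r = ((r.1.1, r.2.1), (r.1.2, r.2.2)) := fun r => rfl
  have hρ : MeasurePreserving ρ volume volume := measurePreserving_regroup ρ hρapp
  have eq3 : (∫ q, G (Ψ.symm q)) = ∫ r, G (Ψ.symm (ρ r)) := (hρ.integral_comp' (fun q => G (Ψ.symm q))).symm
  -- STEP 4: the integrand in split coordinates
  have hΨsymm : ∀ p q : ℝ × EuclideanSpace ℝ (Fin 3), Ψ.symm (p, q) = (e.symm p, e.symm q) := fun p q => rfl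
  have hpt : ∀ r : (ℝ × ℝ) × (EuclideanSpace ℝ (Fin 3) × EuclideanSpace ℝ (Fin 3)),
      G (Ψ.symm (ρ r)) = ((a (-r.1.1) * Real.exp (-r.1.1 ^ 2)) * (c r.1.2 * Real.exp (-r.1.2 ^ 2))) *
        (Real.exp (-‖r.2.1‖ ^ 2) * Real.exp (-‖r.2.2‖ ^ 2) * K (e.symm (r.1.2 - r.1.1, r.2.2 - r.2.1))) := by
    intro r
    rw [hρapp, hΨsymm, hG_def]
    simp only
    rw [thetaTest_apply, hwa, hwc, LinearIsometryEquiv.norm_map, timeReflection_apply, if_pos rfl, hP1, hP1,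
      hP2, hP2, hP3, Prod.mk_sub_mk, neg_add, neg_add, Real.exp_add, Real.exp_add]
    ring
  have hfun : (fun r => G (Ψ.symm (ρ r))) = fun r : (ℝ × ℝ) × (EuclideanSpace ℝ (Fin 3) × EuclideanSpace ℝ (Fin 3)) =>
      ((a (-r.1.1) * Real.exp (-r.1.1 ^ 2)) * (c r.1.2 * Real.exp (-r.1.2 ^ 2))) *
        (Real.exp (-‖r.2.1‖ ^ 2) * Real.exp (-‖r.2.2‖ ^ 2) * K (e.symm (r.1.2 - r.1.1, r.2.2 - r.2.1))) :=
    funext hpt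
  -- integrability survives the transport
  have hI1 : Integrable (fun q => G (Ψ.symm q)) volume :=
    (hΨs.integrable_comp_emb Ψ.symm.measurableEmbedding).mpr hG
  have hI2 : Integrable (fun r => G (Ψ.symm (ρ r))) volume :=
    (hρ.integrable_comp_emb ρ.measurableEmbedding).mpr hI1
  rw [hfun] at hI2
  -- STEP 5: integrate out space first
  have eq4 : (∫ r, G (Ψ.symm (ρ r))) =
      ∫ p : ℝ × ℝ, (a (-p.1) * Real.exp (-p.1 ^ 2)) * (c p.2 * Real.exp (-p.2 ^ 2)) * Φ (p.2 - p.1) := by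
    have hI3 := hI2
    rw [Measure.volume_eq_prod] at hI3
    rw [hfun, Measure.volume_eq_prod, integral_prod _ hI3]
    refine integral_congr_ae (Eventually.of_forall fun p => ?_)
    simp only
    rw [integral_const_mul]
  -- STEP 6: reflect the first time variable
  set ν : ℝ × ℝ ≃ᵐ ℝ × ℝ := MeasurableEquiv.prodCongr (MeasurableEquiv.neg ℝ) (MeasurableEquiv.refl ℝ) with hν_def
  have hν : MeasurePreserving ν volume volume :=
    (Measure.measurePreserving_neg (volume : Measure ℝ)).prod (MeasurePreserving.id (volume : Measure ℝ))
  have eq5 : (∫ p : ℝ × ℝ, (a (-p.1) * Real.exp (-p.1 ^ 2)) * (c p.2 * Real.exp (-p.2 ^ 2)) * Φ (p.2 - p.1)) =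
      ∫ p : ℝ × ℝ, (a p.1 * Real.exp (-p.1 ^ 2)) * (c p.2 * Real.exp (-p.2 ^ 2)) * Φ (p.1 + p.2) := by
    rw [← hν.integral_comp' (fun p : ℝ × ℝ => (a p.1 * Real.exp (-p.1 ^ 2)) * (c p.2 * Real.exp (-p.2 ^ 2)) *
      Φ (p.1 + p.2))]
    refine integral_congr_ae (Eventually.of_forall fun p => ?_)
    have hνp : ν p = (-p.1, p.2) := rfl
    simp only [hνp, neg_sq, neg_add_eq_sub]
  rw [eq1, eq2, eq3, eq4, eq5, one_mul]

end Summit.QuantumFields.YangMills.Cruxes.DetectorRigidity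

end
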